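import Summits.ABC.IUTFork.Joshi.TestRealHonestPacketDH
import Summits.ABC.IUTFork.Joshi.TestPinsInhabitation
import Summits.ABC.IUTFork.Thm311RealIsmDHMoverCriterion
import Summits.ABC.IUTFork.Thm311RealIsmDHMoverAssembled
import HarnessLib

/-!
# Branch E TEST vs S — the (hρ)-EQUIVARIANT PIN AT THE HONEST REAL SETTING over the Dupuy–Hilado (Ind2):
# REFUTED at every number field with a tamely ramified place (abc-iut-E-t41; hand item (a′) of abc-iut-E-cx-2 11:48:53Z)

Companion of `Joshi/TestRealHonestPacket{,DH,Horn}.lean` (p440805 / p441827 / p443555: the INHABITED honest setting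
`honestSetting` over abc-iut-E-t43's `latticeSituationReal`, Θ-images `e⁻¹(p·𝒪_L)`, `q`-image `e⁻¹(𝒪_L)`, for which the
Corollary's two REGION pins (pΘ)/(pq′) are inhabited for every column family) and of abc-iut-E-cx-2's criterion file
`Joshi/TestPinsInhabitation.lean` (p441977). QUESTION (a′): does a region reading `ρ` exist satisfying the FULL pin predicate
`Cor312Vol.PinnedRegions` — i.e. ALSO the (hρ)-half «`ρ` transforms with the data under `⟨(Ind1) ∪ (Ind2)⟩`» — at `honestSetting`
over the Dupuy–Hilado binders (`stripAutDH`, `ismDH logv`)? ANSWER (kernel, this file): **NO, for every number field `F` having a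
TAMELY RAMIFIED place** `v₀ | p₀` (`p₀ > 2`, `2 ≤ e(v₀|p₀) ≤ p₀ − 2`; e.g. `ℚ(√5)` at `5`) — for EVERY column family, column, box
prime, auxiliary data, `ρ` and `qK` (`not_pinnedRegions_honestSetting_DH`). PROOF-ONLY.

MECHANISM (E-cx-2's asymmetry, [J-III]-independent): the Kummer data `qK`, `Ψ^Θ_m` live in the STAR packets `∏_{j ∈ 𝔽_l^⋇} 𝓘(…)`
over BAD places, so every `Φ ∈ ⟨(Ind1) ∪ (Ind2)⟩` acting trivially there stabilises them, and (hρ) + (pq′) force `Φ` to stabilise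
the `q`-image at EVERY packet (p441977 `qStabiliser_preserves_qRegion_of_pinnedRegions`). Take the (Ind2)-GENERATOR `Φ₀` :=
«at the ZERO label, `⊕_v g_v` with `g_{v₀} := g` a Dupuy–Hilado lattice automorphism of `I_{v₀}` MOVING the unit ball `𝒪_{v₀}`
(abc-iut-w5-d216's TAME MOVER CRITERION `exists_mem_ismDH_image_closedBall_ne_of_tame`, Thm311RealIsmDHMoverCriterion: at a tame
place the (Ind2)-stable balls are the `𝔪^j` with `e ∣ j − 1`, so `𝒪 = 𝔪^0` is moved once `e ≥ 2`), identity elsewhere; identity at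
every nonzero label». It acts trivially on every star packet (labels `≠ 0` only), yet at the packet `(0, p₀)` it carries the test
vector `⊗(z at v₀, 0 elsewhere)` — which lies in `e⁻¹(𝒪_L)` iff `z ∈ 𝒪_{v₀}` (the factor embeddings are isometric,
`IsmDHMover.mem_normalizedPacket_iff_norm_dEquiv_le`) — to `⊗(g z, 0, …)`: contradiction. HONEST READING (located, not
adjudicated): what is refuted is the conjunction, AS TYPED, of (i) our `Cor312Vol.ThetaPinned`.1 — equivariance of `ρ` under the
FULL closure `⟨Ind1 ∪ Ind2⟩` acting on RAW regions at ALL labels INCLUDING `j = 0` (never read by Cor. 3.12's average over `𝔽_l^⋇`)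
—, (ii) Dupuy–Hilado's (Ind2) `Real.ismDH` (ALL bicontinuous `φ` with `φ(I_v) = I_v`, not only isometries), and (iii) `𝒪_L`-SHAPED
pilot boxes at the zero label of `honestSetting`. Obvious repairs, each defeating THIS witness: restrict (hρ) to labels `j ∈ 𝔽_l^⋇`
or to the stabiliser-relevant packets; read (Ind2) as isometries ([IUTchII] Ex. 1.8 (iv), EL-079); take `univ` boxes at `j = 0`
(abc-iut-E-t41 gen 0's zero-label convention, p431588); read regions up to holomorphic hull. The S-form theorems that ASSUME
`PinnedRegions` at these carriers (`real_not_pilotKummerIndRelated_or_not_statement`, …) are thereby VACUOUSLY true at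
`honestSetting` over (stripAutDH, ismDH) for such `F`; the IndCoversQ-form results (p440805 / p441827 / p443555) are untouched
(they use the region pins only). **No side is taken** on [IUTchIII] Cor. 3.12 or on any author (Mochizuki / Scholze–Stix / Joshi /
Dupuy–Hilado); typed ≠ proved ≠ endorsed. [claim: Mochizuki2012, status: disputed] [cite: DupuyHilado2025, §4.9]
[cite: WeilBNT1967, Ch. II §2, Th. 2] [cite: NeukirchANT1999, Ch. II Prop. (5.5)]. Standard axioms only; no `sorry`; R14: `Joshi/Test*`.
-/

noncomputable section

open Metric Set Function NumberField IsDedekindDomain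
open scoped Pointwise

namespace Summit.ABC.IUTFork.Joshi

open Thm311 Thm311.Real Cor312 Cor312Vol Literature.IUT.LogThetaLattice Literature.IUT.LogVolume
open Literature.NumberTheory.NumberFields Literature.NumberTheory.GaloisRepresentations.Ultrametric

/-! ## 1. The abstract half at ANY binders: an (hρ)-pinned reading makes every bad-trivial Φ stabilise both images everywhere -/

section Abstract

variable {F : Type} [Field F] [NumberField F] (X : PilotData F) {logv : PadicLogs F} (hlog : LogvAnalytic logv)
  (Aut Ism : ∀ x : Place F, Set (Carrier x ≃ₗ[ℚ] Carrier x))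
  (hAut : ∀ x, LinearEquiv.refl ℚ (Carrier x) ∈ Aut x) (hIsm : ∀ x, LinearEquiv.refl ℚ (Carrier x) ∈ Ism x)
  (M : Type) [Field M] [NumberField M]
  (archPk : ∀ (j : (thetaIndex X).Label) (vQ : (thetaIndex X).VQ), Set ((logShells X logv Aut Ism hAut hIsm).Packet j vQ))
  (archSub : ∀ (j : (thetaIndex X).Label) (v : (thetaIndex X).V),
    Set ((logShells X logv Aut Ism hAut hIsm).Packet j ((thetaIndex X).over v)))
  (Ψ : ℤ → ∀ v : (thetaIndex X).V, v ∈ (thetaIndex X).Vbad → Set ((logShells X logv Aut Ism hAut hIsm).StarPacket v))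
  (act : ℤ → ∀ v : (thetaIndex X).V, v ∈ (thetaIndex X).Vbad →
    (logShells X logv Aut Ism hAut hIsm).StarPacket v → Module.End ℚ ((logShells X logv Aut Ism hAut hIsm).StarPacket v))
  (Mmod : ℤ → ∀ j : (thetaIndex X).LabelStar, Set ((logShells X logv Aut Ism hAut hIsm).GlobalPacket j.1))
  (region : ℤ → ∀ j : (thetaIndex X).LabelStar, FinDivisor M → ∀ vQ : (thetaIndex X).VQ,
    Set ((logShells X logv Aut Ism hAut hIsm).Packet j.1 vQ))
  (col : ℤ → Column (logShells X logv Aut Ism hAut hIsm)) (n : ℤ) (p : ℕ)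
  {ρ : (∀ v : (thetaIndex X).V, v ∈ (thetaIndex X).Vbad → Set ((logShells X logv Aut Ism hAut hIsm).StarPacket v)) →
    ∀ (j : (thetaIndex X).Label) (vQ : (thetaIndex X).VQ), Set ((logShells X logv Aut Ism hAut hIsm).Packet j vQ)}
  {qK : ∀ v : (thetaIndex X).V, v ∈ (thetaIndex X).Vbad → Set ((logShells X logv Aut Ism hAut hIsm).StarPacket v)}

/-- **The abstract half (any `Aut`/`Ism`)**: an (hρ)-PINNED reading at the honest setting forces EVERY `Φ ∈ ⟨(Ind1) ∪ (Ind2)⟩` acting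
trivially on the bad star packets to stabilise BOTH images `e⁻¹(p·𝒪_L)` and `e⁻¹(𝒪_L)` at EVERY packet — in particular at the zero
label and over the primes carrying no bad place, where `Φ` is unconstrained by any datum (p441977, by `exact`).
[claim: Mochizuki2012, status: disputed] -/
theorem honestSetting_images_stable_of_pinnedRegions
    (h : PinnedRegions (latticeSituationReal X hlog Aut Ism hAut hIsm M archPk archSub Ψ act Mmod region col)
      (honestSetting X hlog Aut Ism hAut hIsm M archPk archSub Ψ act Mmod region col n p) ρ qK)
    {Φ : (logShells X logv Aut Ism hAut hIsm).PacketAut}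
    (hΦ : Φ ∈ Subgroup.closure ((logShells X logv Aut Ism hAut hIsm).Ind1Family ∪ (logShells X logv Aut Ism hAut hIsm).Ind2Family))
    (hid : ∀ (v : (thetaIndex X).V), v ∈ (thetaIndex X).Vbad →
      (logShells X logv Aut Ism hAut hIsm).starAut Φ v = LinearEquiv.refl ℚ _)
    (m : ℤ) (j : (thetaIndex X).Label) (vQ : (thetaIndex X).VQ) :
    Φ j vQ '' (honestSetting X hlog Aut Ism hAut hIsm M archPk archSub Ψ act Mmod region col n p).thetaRegion m j vQ =
        (honestSetting X hlog Aut Ism hAut hIsm M archPk archSub Ψ act Mmod region col n p).thetaRegion m j vQ ∧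
      Φ j vQ '' (honestSetting X hlog Aut Ism hAut hIsm M archPk archSub Ψ act Mmod region col n p).qRegion j vQ =
        (honestSetting X hlog Aut Ism hAut hIsm M archPk archSub Ψ act Mmod region col n p).qRegion j vQ :=
  by
  have hstab : (fun v hv => (logShells X logv Aut Ism hAut hIsm).starAut Φ v '' qK v hv) = qK :=
    funext fun v => funext fun hv => by rw [hid v hv]; exact Set.image_id' _
  exact ⟨thetaRegion_stable_of_starAut_eq_refl
      (latticeSituationReal X hlog Aut Ism hAut hIsm M archPk archSub Ψ act Mmod region col)
      (honestSetting X hlog Aut Ism hAut hIsm M archPk archSub Ψ act Mmod region col n p) h.1 hΦ hid m j vQ,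
    qStabiliser_preserves_qRegion_of_pinnedRegions
      (latticeSituationReal X hlog Aut Ism hAut hIsm M archPk archSub Ψ act Mmod region col)
      (honestSetting X hlog Aut Ism hAut hIsm M archPk archSub Ψ act Mmod region col n p) qK h hΦ hstab j vQ⟩

end Abstract

/-! ## 2. The Dupuy–Hilado binders at a tamely ramified place: the zero-label mover REFUTES the equivariant pin -/

section DH

variable {F : Type} [Field F] [NumberField F] (X : PilotData F) {logv : PadicLogs F} (hlog : LogvAnalytic logv)
  (M : Type) [Field M] [NumberField M]
  (archPk : ∀ (j : (thetaIndex X).Label) (vQ : (thetaIndex X).VQ), Set ((logShellsDH X logv).Packet j vQ))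
  (archSub : ∀ (j : (thetaIndex X).Label) (v : (thetaIndex X).V), Set ((logShellsDH X logv).Packet j ((thetaIndex X).over v)))
  (Ψ : ℤ → ∀ v : (thetaIndex X).V, v ∈ (thetaIndex X).Vbad → Set ((logShellsDH X logv).StarPacket v))
  (act : ℤ → ∀ v : (thetaIndex X).V, v ∈ (thetaIndex X).Vbad →
    (logShellsDH X logv).StarPacket v → Module.End ℚ ((logShellsDH X logv).StarPacket v))
  (Mmod : ℤ → ∀ j : (thetaIndex X).LabelStar, Set ((logShellsDH X logv).GlobalPacket j.1))
  (region : ℤ → ∀ j : (thetaIndex X).LabelStar, FinDivisor M → ∀ vQ : (thetaIndex X).VQ, Set ((logShellsDH X logv).Packet j.1 vQ))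
  (col : ℤ → Column (logShellsDH X logv)) (n : ℤ) (p : ℕ)

/-- **`not_pinnedRegions_honestSetting_DH` — THE (hρ)-EQUIVARIANT PIN IS UNINHABITED at the honest real setting over the
Dupuy–Hilado (Ind1)/(Ind2) whenever `F` has a TAMELY RAMIFIED place** `v₀ | p₀` (`p₀ > 2`, `2 ≤ e(v₀|p₀) ≤ p₀ − 2`): for every
column family `col`, column `n`, box prime `p`, auxiliary data, region reading `ρ` and `q`-datum `qK`, `¬ PinnedRegions`. Witness:
the zero-label (Ind2)-generator built from a tame MOVER of `𝒪_{v₀}` (module docstring). Located, not adjudicated: a statement about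
OUR typing ((hρ) at all labels on raw regions ∧ DH's full (Ind2) ∧ `𝒪_L`-boxes at `j = 0`), with the repairs listed in the module
docstring. [claim: Mochizuki2012, status: disputed] [cite: DupuyHilado2025, §4.9] [cite: WeilBNT1967, Ch. II §2, Th. 2] -/
theorem not_pinnedRegions_honestSetting_DH (pp : Nat.Primes) (hp2 : 2 < (pp : ℕ)) (v₀ : HeightOneSpectrum (𝓞 F))
    (hv₀ : (thetaIndex X).over (.inr v₀) = .inr pp) (he2 : 2 ≤ v₀.asIdeal.ramificationIdx ℤ)
    (he : v₀.asIdeal.ramificationIdx ℤ ≤ (pp : ℕ) - 2)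
    (ρ : (∀ v : (thetaIndex X).V, v ∈ (thetaIndex X).Vbad → Set ((logShellsDH X logv).StarPacket v)) →
      ∀ (j : (thetaIndex X).Label) (vQ : (thetaIndex X).VQ), Set ((logShellsDH X logv).Packet j vQ))
    (qK : ∀ v : (thetaIndex X).V, v ∈ (thetaIndex X).Vbad → Set ((logShellsDH X logv).StarPacket v)) :
    ¬ PinnedRegions (latticeSituationReal X hlog stripAutDH (ismDH logv) refl_mem_stripAutDH (refl_mem_ismDH logv) M archPk
        archSub Ψ act Mmod region col)
      (honestSetting X hlog stripAutDH (ismDH logv) refl_mem_stripAutDH (refl_mem_ismDH logv) M archPk archSub Ψ act Mmod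
        region col n p) ρ qK := by
  classical
  intro hpin
  haveI hpF : Fact (pp : ℕ).Prime := ⟨pp.2⟩
  let L := logShellsDH X logv
  set x₀ : (thetaIndex X).Fibre (.inr pp) := ⟨.inr v₀, hv₀⟩ with hx₀def
  set P := presAt X hlog pp
  have hlab : (((0 : (thetaIndex X).Label)) : ℕ) = 0 := Fin.val_zero _
  have hv : ((pp : ℕ) : 𝓞 F) ∈ v₀.asIdeal := natCast_mem_placeOf X pp x₀
  -- §a. a TAME MOVER of the unit ball `𝒪_{v₀}` inside Dupuy–Hilado's (Ind2) (w5-d216's criterion: `𝒪 = 𝔪^0`, `e ∤ 0 − 1`)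
  obtain ⟨ϖ, hϖ, -⟩ := exists_isUniformizer_rescaledCompletion F pp v₀ hv
  have hj : ¬ ((v₀.asIdeal.ramificationIdx ℤ : ℕ) : ℤ) ∣ ((0 : ℤ) - 1) := by
    intro hd
    rw [zero_sub, dvd_neg] at hd
    have h1 := Int.eq_one_of_dvd_one (by positivity) hd
    omega
  obtain ⟨g, hg, hmov⟩ := exists_mem_ismDH_image_closedBall_ne_of_tame (hlog pp) hp2 he hϖ (t := 1) (j := 0)
    (by rw [norm_one, zpow_zero]) hj
  -- the moved unit ball, read on the carrier `Carrier (.inr v₀)` (= `K_{v₀}^{(1/n)}` as a type; `toR`/`ofR` are the identity)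
  let Bc : Set (Carrier (.inr v₀ : Place F)) := {z | ‖toR (pp : ℕ) v₀ hv z‖ ≤ 1}
  have hmem_Bc : ∀ z : Carrier (.inr v₀ : Place F), z ∈ Bc ↔ ‖toR (pp : ℕ) v₀ hv z‖ ≤ 1 := fun z => Iff.rfl
  have hgBc : ⇑g '' Bc ≠ Bc := by
    intro h
    apply hmov
    rw [norm_one]
    have hBc2 : (closedBall (0 : RescaledCompletion F (pp : ℕ) v₀ hv) 1) = Bc := by
      ext a
      rw [mem_closedBall_zero_iff]
      exact Iff.rfl
    rw [hBc2]
    exact h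
  -- §b. the ZERO-LABEL (Ind2)-generator: `g` at `v₀`, identity at the other places; identity at every nonzero label
  let gPl : ∀ y : Place F, Carrier y ≃ₗ[ℚ] Carrier y := fun y =>
    if h : y = .inr v₀ then (by subst h; exact g) else LinearEquiv.refl ℚ (Carrier y)
  have hgPl_v₀ : gPl (.inr v₀) = g := by
    show (if h : (Sum.inr v₀ : Place F) = .inr v₀ then _ else _) = g
    rw [dif_pos rfl]
  have hgPl_mem : ∀ y : Place F, gPl y ∈ ismDH logv y := by
    intro y
    by_cases hy : y = .inr v₀
    · subst hy; rw [hgPl_v₀]; exact hg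
    · show (if h : y = .inr v₀ then _ else _) ∈ _
      rw [dif_neg hy]; exact refl_mem_ismDH _ y
  let Φ₀ : L.PacketAut := fun j vQ =>
    if j = 0 then L.factorwise j vQ fun _ => L.summandwise vQ fun v => gPl v.1 else LinearEquiv.refl ℚ _
  have hΦ₀_zero : ∀ vQ, Φ₀ 0 vQ = L.factorwise 0 vQ fun _ => L.summandwise vQ fun v => gPl v.1 := fun vQ => if_pos rfl
  have hΦ₀_ne : ∀ (j : (thetaIndex X).Label) (vQ), j ≠ 0 → Φ₀ j vQ = LinearEquiv.refl ℚ _ := fun j vQ hj0 => if_neg hj0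
  have hΦ₀ : Φ₀ ∈ L.Ind2Family := by
    intro j vQ
    by_cases hj0 : j = 0
    · subst hj0
      exact ⟨fun _ v => gPl v.1, fun _ v => hgPl_mem v.1, hΦ₀_zero vQ⟩
    · rw [show Φ₀ j vQ = LinearEquiv.refl ℚ _ from hΦ₀_ne j vQ hj0]
      exact L.refl_mem_Ind2 j vQ
  have hΦ₀c : Φ₀ ∈ Subgroup.closure (L.Ind1Family ∪ L.Ind2Family) := Subgroup.subset_closure (Or.inr hΦ₀)
  -- it acts TRIVIALLY on every star packet (labels `j ≠ 0` only)
  have hid : ∀ (v : (thetaIndex X).V), v ∈ (thetaIndex X).Vbad → L.starAut Φ₀ v = LinearEquiv.refl ℚ _ := by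
    intro v _
    refine LinearEquiv.ext fun f => funext fun j => ?_
    show (Φ₀ j.1 ((thetaIndex X).over v)) (f j) = f j
    rw [hΦ₀_ne j.1 _ j.2]
    rfl
  -- §c. hence (p441977) it stabilises the `q`-image `e⁻¹(𝒪_L)` at the packet `(0, p₀)`
  have hEq := (honestSetting_images_stable_of_pinnedRegions X hlog stripAutDH (ismDH logv) refl_mem_stripAutDH
    (refl_mem_ismDH logv) M archPk archSub Ψ act Mmod region col n p hpin hΦ₀c hid 0 0 (.inr pp)).2
  rw [honestSetting_qRegion, preimage_factorMapDH_hullSet_one X hlog 0 pp] at hEq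
  -- §d. test vectors `⊗(z at v₀, 0 elsewhere)`; membership in `e⁻¹(Π (R_{v⃗})^∼)` reads `‖z‖ ≤ 1`
  let y1 : Carrier (.inr v₀ : Place F) → L.Packet1 (.inr pp) := fun z => Pi.single x₀ z
  have hy1_x₀ : ∀ z, y1 z x₀ = z := fun z => Pi.single_eq_same _ _
  have hy1_ne : ∀ z (v : (thetaIndex X).Fibre (.inr pp)), v ≠ x₀ → y1 z v = 0 := fun z v hv' => Pi.single_eq_of_ne hv' _
  let xz : Carrier (.inr v₀ : Place F) → L.Packet 0 (.inr pp) := fun z => L.tprod 0 (.inr pp) fun _ => y1 z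
  -- `φ_{v₀} = id`: the presentation coordinate of `z` IS `z`, with the rescaled norm
  have hφx₀ : ∀ z : Carrier (.inr v₀ : Place F), ‖P.φ x₀ z‖ = ‖toR (pp : ℕ) v₀ hv z‖ := fun z => rfl
  have hall : ∀ z, z ∈ Bc → ∀ v : (thetaIndex X).Fibre (.inr pp), ‖P.φ v (y1 z v)‖ ≤ 1 := by
    intro z hz v
    by_cases hv' : v = x₀
    · subst hv'
      rw [hy1_x₀, hφx₀]
      exact hz
    · rw [hy1_ne z v hv', map_zero, norm_zero]
      exact zero_le_one
  have hmem_xz : ∀ z, xz z ∈ P.comparison 0 ⁻¹' (Set.pi univ fun ev =>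
      (normalizedPacket pp.1 (P.kk ev) : Set (P.X ev))) ↔ z ∈ Bc := by
    intro z
    rw [hmem_Bc, Set.mem_preimage, Set.mem_univ_pi]
    constructor
    · intro h
      have h0 := h (fun _ => x₀)
      rw [show P.comparison 0 (xz z) (fun _ => x₀) = _ from P.comparison_tprod 0 (fun _ => y1 z) (fun _ => x₀),
        IsmDHMover.tprod_eq_iota_last _ hlab, SetLike.mem_coe,
        IsmDHMover.mem_normalizedPacket_iff_norm_dEquiv_le] at h0
      obtain ⟨i⟩ := nonempty_dIdx pp.1 (P.kk fun _ : (thetaIndex X).Caps 0 => x₀)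
      have h1 := h0 i
      rw [norm_dEquiv_iota, hy1_x₀, hφx₀] at h1
      exact h1
    · intro hz ev
      rw [show P.comparison 0 (xz z) ev = _ from P.comparison_tprod 0 (fun _ => y1 z) ev,
        IsmDHMover.tprod_eq_iota_last _ hlab, SetLike.mem_coe, IsmDHMover.mem_normalizedPacket_iff_norm_dEquiv_le]
      intro i
      rw [norm_dEquiv_iota]
      exact hall z hz (ev (Fin.last _))
  -- §e. the generator acts on the test vectors by `g` at `v₀`
  have hΦxz : ∀ z, Φ₀ 0 (.inr pp) (xz z) = xz (g z) := by
    intro z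
    rw [hΦ₀_zero]
    show L.factorwise 0 (.inr pp) (fun _ => L.summandwise (.inr pp) fun v => gPl v.1)
        (L.tprod 0 (.inr pp) fun _ => y1 z) = L.tprod 0 (.inr pp) fun _ => y1 (g z)
    rw [L.factorwise_summandwise_tprod]
    congr 1
    funext a v
    by_cases hv' : v = x₀
    · rw [hv', hy1_x₀, hy1_x₀]
      show gPl (.inr v₀) z = g z
      rw [hgPl_v₀]
    · rw [hy1_ne z _ hv', hy1_ne (g z) _ hv', map_zero]
  -- §f. contradiction: `Φ₀` does not map `e⁻¹(Π (R)^∼)` onto itself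
  have key : ∀ x, x ∈ _ ↔ Φ₀ 0 (.inr pp) x ∈ _ := fun x =>
    ((Φ₀ 0 (.inr pp)).injective.mem_set_image).symm.trans (Set.ext_iff.mp hEq (Φ₀ 0 (.inr pp) x))
  rcases IsmDHMover.exists_of_image_ne g.toEquiv hgBc with ⟨z, hz, hgz⟩ | ⟨z, hz, hgz⟩
  · have h1 : Φ₀ 0 (.inr pp) (xz z) ∈ _ := (key (xz z)).mp ((hmem_xz z).mpr hz)
    have h2 := (hΦxz z) ▸ h1
    exact hgz ((hmem_xz (g z)).mp h2)
  · have h1 : xz (g z) ∈ _ := (hmem_xz (g z)).mpr hgz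
    have h2 := (hΦxz z).symm ▸ h1
    exact hz ((hmem_xz z).mp ((key (xz z)).mpr h2))

/-- **Packaged for the S-form consumers**: at such `F`, the antecedent of every «(hρ)-pins ⟹ …» theorem at `honestSetting` over the
Dupuy–Hilado binders is EMPTY — `∀ ρ qK, ¬ PinnedRegions` (so those theorems are VACUOUS there, while the region-pin results
p440805/p441827/p443555 are untouched). [claim: Mochizuki2012, status: disputed] -/
theorem not_exists_pinnedRegions_honestSetting_DH (pp : Nat.Primes) (hp2 : 2 < (pp : ℕ)) (v₀ : HeightOneSpectrum (𝓞 F))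
    (hv₀ : (thetaIndex X).over (.inr v₀) = .inr pp) (he2 : 2 ≤ v₀.asIdeal.ramificationIdx ℤ)
    (he : v₀.asIdeal.ramificationIdx ℤ ≤ (pp : ℕ) - 2) :
    ¬ ∃ (ρ : (∀ v : (thetaIndex X).V, v ∈ (thetaIndex X).Vbad → Set ((logShellsDH X logv).StarPacket v)) →
          ∀ (j : (thetaIndex X).Label) (vQ : (thetaIndex X).VQ), Set ((logShellsDH X logv).Packet j vQ))
        (qK : ∀ v : (thetaIndex X).V, v ∈ (thetaIndex X).Vbad → Set ((logShellsDH X logv).StarPacket v)),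
      PinnedRegions (latticeSituationReal X hlog stripAutDH (ismDH logv) refl_mem_stripAutDH (refl_mem_ismDH logv) M archPk
          archSub Ψ act Mmod region col)
        (honestSetting X hlog stripAutDH (ismDH logv) refl_mem_stripAutDH (refl_mem_ismDH logv) M archPk archSub Ψ act Mmod
          region col n p) ρ qK :=
  fun ⟨ρ, qK, h⟩ => not_pinnedRegions_honestSetting_DH X hlog M archPk archSub Ψ act Mmod region col n p pp hp2 v₀ hv₀ he2 he ρ qK h

end DH

end Summit.ABC.IUTFork.Joshi

end
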